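import Literature.NumberTheory.Transcendental.ExpPointsLogFreeUniformize
import HarnessLib

/-!
# Log-free ends of a curve of exponential points: the cusp form WITH its uniformisation

Same setting and same construction as `ExpPointsLogFreeUniformize.exists_cusp_form_of_logFree`:
from the branch `𝔟(t) = ((t⁻ᵉ, Φ₁ t / tᴺ), (Φ₂ t / tᴺ, Φ₃ t / tᴺ)) ⊆ W` of a LOG-FREE end
(`Φ₂ t / tᴺ = e^{ℓ₀ t}`, `Φ₃ t / tᴺ = e^{ℓ₁ t}`) one passes to the cusp form
`𝔠(s) = ((2πi ε s⁻ᵉ + ℓu s, 2πi (A(s⁻¹) + g s) + ℓv s), (e^{ℓu s}, e^{ℓv s}))`, `ε = ±1`, through the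
uniformizing substitution `t = T(s) = τ(η s)` (`AnalyticLocalUniformizer`, `η^{2e} = 1`), with
`ℓu := ℓ₀ ∘ T`, `ℓv := ℓ₁ ∘ T`. The theorem `exists_cusp_form_of_logFree_alg` is exactly
`exists_cusp_form_of_logFree` with the substitution REMEMBERED: `T` is analytic at `0`,
`T 0 = 0`, the `t`-branch `((t⁻ᵉ, Φ₁ t / tᴺ), (e^{ℓ₀ t}, e^{ℓ₁ t}))` lies in `W` for `0 < |t| < r`,
and for `0 < |s| < ρ₀` one has `0 < |T s| < r`, `(T s)⁻ᵉ = 2πi ε s⁻ᵉ + ℓu s`,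
`Φ₁ (T s) / (T s)ᴺ = 2πi (A(s⁻¹) + g s) + ℓv s`, `ℓ₀ (T s) = ℓu s`, `ℓ₁ (T s) = ℓv s` — i.e. the
cusp point at `s` IS the branch point at `t = T s`. (The `t`-coordinate is the algebraic one:
`x₀ = t⁻ᵉ` exactly.) PROVED, no definition. [folklore]
-/

noncomputable section

open Complex Filter Topology Set Metric Polynomial

namespace Literature.NumberTheory.Transcendental

open Literature.Analysis.Complex.LocalUniformizer (exists_uniformizer)
open Literature.Analysis.Complex.PrincipalPart (exists_principal_part)

/-- The branch point `((t⁻ᵉ, Φ₁ t / tᴺ), (Φ₂ t / tᴺ, Φ₃ t / tᴺ)) ∈ ℂ² × ℂ²` (local notation). -/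
local notation3 "𝔟[" e ", " N ", " Φ₁ ", " Φ₂ ", " Φ₃ ", " t "]" =>
  (Sum.elim ![((t : ℂ) ^ (e : ℕ))⁻¹, (Φ₁ : ℂ → ℂ) t / t ^ (N : ℕ)]
    ![(Φ₂ : ℂ → ℂ) t / t ^ (N : ℕ), (Φ₃ : ℂ → ℂ) t / t ^ (N : ℕ)] : Fin 2 ⊕ Fin 2 → ℂ)

/-- The branch point in exponential form `((t⁻ᵉ, Φ₁ t / tᴺ), (e^{ℓ₀ t}, e^{ℓ₁ t}))` (local notation). -/
local notation3 "𝔟ₑ[" e ", " N ", " Φ₁ ", " ℓ₀ ", " ℓ₁ ", " t "]" =>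
  (Sum.elim ![((t : ℂ) ^ (e : ℕ))⁻¹, (Φ₁ : ℂ → ℂ) t / t ^ (N : ℕ)]
    ![Complex.exp ((ℓ₀ : ℂ → ℂ) t), Complex.exp ((ℓ₁ : ℂ → ℂ) t)] : Fin 2 ⊕ Fin 2 → ℂ)

/-- The cusp form `((2πi ε s⁻ᵉ + ℓu s, 2πi (A(s⁻¹) + g s) + ℓv s), (e^{ℓu s}, e^{ℓv s}))`
(local notation). -/
local notation3 "𝔠[" ε ", " e ", " A ", " g ", " ℓu ", " ℓv ", " s "]" =>
  (Sum.elim ![2 * (Real.pi : ℂ) * I * (ε : ℂ) * (s : ℂ)⁻¹ ^ (e : ℕ) + (ℓu : ℂ → ℂ) s,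
      2 * (Real.pi : ℂ) * I * (Polynomial.eval s⁻¹ (A : ℂ[X]) + (g : ℂ → ℂ) s) + (ℓv : ℂ → ℂ) s]
    ![Complex.exp ((ℓu : ℂ → ℂ) s), Complex.exp ((ℓv : ℂ → ℂ) s)] : Fin 2 ⊕ Fin 2 → ℂ)

/-- **Cusp form of a log-free end, with its uniformisation.** In the setting of the module
docstring (log-free: `yⱼ = e^{ℓⱼ(t)}` on the branch), there are `ε = ±1`, `A ∈ ℂ[w]`, germs
`g, ℓu, ℓv` analytic at `0` with `g 0 = 0`, `ρ₀ > 0`, such that the cusp form `𝔠(s)` lies in `W`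
for `0 < |s| < ρ₀` and infinitely many independent exponential points of `W` are of the form
`(x, eˣ) = 𝔠(ρ)` with REAL `0 < ρ < δ`, for every `δ > 0`; AND a germ `T` analytic at `0`,
`T 0 = 0`, and `r > 0` such that the `t`-branch `((t⁻ᵉ, Φ₁ t / tᴺ), (e^{ℓ₀ t}, e^{ℓ₁ t}))` lies in
`W` for `0 < |t| < r` and, for `0 < |s| < ρ₀`: `0 < |T s| < r`, `(T s)⁻ᵉ = 2πi ε s⁻ᵉ + ℓu s`,
`Φ₁ (T s) / (T s)ᴺ = 2πi (A(s⁻¹) + g s) + ℓv s`, `ℓ₀ (T s) = ℓu s` and `ℓ₁ (T s) = ℓv s`.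
[folklore] -/
theorem exists_cusp_form_of_logFree_alg {W : Set (Fin 2 ⊕ Fin 2 → ℂ)} {e : ℕ} (he : 0 < e)
    {N : ℕ} {Φ₁ Φ₂ Φ₃ : ℂ → ℂ} (hΦ₁ : AnalyticAt ℂ Φ₁ 0)
    (hW : ∀ᶠ t in 𝓝[≠] (0 : ℂ), 𝔟[e, N, Φ₁, Φ₂, Φ₃, t] ∈ W)
    (hhit : ∀ δ : ℝ, 0 < δ → Set.Infinite {x | x ∈ indepExpPoints W ∧ ∃ t : ℂ, 0 < ‖t‖ ∧
      ‖t‖ < δ ∧ Sum.elim x (Complex.exp ∘ x) = 𝔟[e, N, Φ₁, Φ₂, Φ₃, t]})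
    {ℓ₀ ℓ₁ : ℂ → ℂ} (hℓ₀ : AnalyticAt ℂ ℓ₀ 0) (hℓ₁ : AnalyticAt ℂ ℓ₁ 0)
    (hy₀ : ∀ᶠ t in 𝓝[≠] (0 : ℂ), Φ₂ t / t ^ N = exp (ℓ₀ t))
    (hy₁ : ∀ᶠ t in 𝓝[≠] (0 : ℂ), Φ₃ t / t ^ N = exp (ℓ₁ t)) :
    ∃ (ε : ℂ) (A : ℂ[X]) (g ℓu ℓv : ℂ → ℂ) (ρ₀ : ℝ) (T : ℂ → ℂ) (r : ℝ), (ε = 1 ∨ ε = -1) ∧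
      0 < ρ₀ ∧ AnalyticAt ℂ g 0 ∧ g 0 = 0 ∧ AnalyticAt ℂ ℓu 0 ∧ AnalyticAt ℂ ℓv 0 ∧
      (∀ s : ℂ, 0 < ‖s‖ → ‖s‖ < ρ₀ → 𝔠[ε, e, A, g, ℓu, ℓv, s] ∈ W) ∧
      (∀ δ : ℝ, 0 < δ → Set.Infinite {x | x ∈ indepExpPoints W ∧ ∃ ρ : ℝ, 0 < ρ ∧ ρ < δ ∧
        Sum.elim x (Complex.exp ∘ x) = 𝔠[ε, e, A, g, ℓu, ℓv, (ρ : ℂ)]}) ∧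
      0 < r ∧ AnalyticAt ℂ T 0 ∧ T 0 = 0 ∧
      (∀ t : ℂ, 0 < ‖t‖ → ‖t‖ < r → 𝔟ₑ[e, N, Φ₁, ℓ₀, ℓ₁, t] ∈ W) ∧
      (∀ s : ℂ, 0 < ‖s‖ → ‖s‖ < ρ₀ → 0 < ‖T s‖ ∧ ‖T s‖ < r ∧
        ((T s) ^ e)⁻¹ = 2 * (Real.pi : ℂ) * I * ε * s⁻¹ ^ e + ℓu s ∧
        Φ₁ (T s) / (T s) ^ N = 2 * (Real.pi : ℂ) * I * (Polynomial.eval s⁻¹ A + g s) + ℓv s ∧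
        ℓ₀ (T s) = ℓu s ∧ ℓ₁ (T s) = ℓv s) := by
  classical
  have h2πI : (2 * (Real.pi : ℂ) * I) ≠ 0 := by simp [Real.pi_ne_zero, I_ne_zero]
  -- ### Step A: `F₀ = (t⁻ᵉ - ℓ₀)/2πi = V(t)/tᵉ`, uniformizer `F₀ = σ(t)⁻ᵉ`
  set V : ℂ → ℂ := fun t => (1 - t ^ e * ℓ₀ t) / (2 * Real.pi * I) with hVdef
  have hV : AnalyticAt ℂ V 0 :=
    (analyticAt_const.sub ((analyticAt_id.pow e).mul hℓ₀)).div analyticAt_const h2πI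
  have hV0 : V 0 ≠ 0 := by
    simp only [hVdef, zero_pow he.ne', zero_mul, sub_zero]
    exact div_ne_zero one_ne_zero h2πI
  obtain ⟨σ, τ, w, u, hσ, hτ, hw, hu, hw0, hu0, hσw, hτu, hστ, hτσ, hunif⟩ :=
    exists_uniformizer hV hV0 he
  have hF₀ : ∀ᶠ t in 𝓝[≠] (0 : ℂ), σ t ≠ 0 ∧
      (t ^ e)⁻¹ = 2 * Real.pi * I * ((σ t) ^ e)⁻¹ + ℓ₀ t := by
    have hwne : ∀ᶠ t in 𝓝 (0 : ℂ), w t ≠ 0 := hw.continuousAt.eventually_ne hw0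
    filter_upwards [eventually_nhdsWithin_of_eventually_nhds (hunif.and hwne),
      self_mem_nhdsWithin] with t ⟨hun, hwt⟩ ht0
    have htne : t ≠ 0 := by rintro rfl; exact ht0 (Set.mem_singleton 0)
    have hσne : σ t ≠ 0 := by rw [hσw]; exact mul_ne_zero htne hwt
    refine ⟨hσne, ?_⟩
    have hVt : V t = t ^ e / (σ t) ^ e := by
      rw [eq_div_iff (pow_ne_zero e hσne), mul_comm]; exact hun
    have hVt' : (1 - t ^ e * ℓ₀ t) = 2 * Real.pi * I * (t ^ e / (σ t) ^ e) := by
      rw [← hVt, hVdef]; field_simp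
    have key : (t ^ e)⁻¹ * (1 - t ^ e * ℓ₀ t) = 2 * Real.pi * I * ((σ t) ^ e)⁻¹ := by
      rw [hVt']; field_simp
    calc (t ^ e)⁻¹ = (t ^ e)⁻¹ * (1 - t ^ e * ℓ₀ t) + ℓ₀ t := by field_simp; ring
      _ = 2 * Real.pi * I * ((σ t) ^ e)⁻¹ + ℓ₀ t := by rw [key]
  -- ### Step B: radii and integrality at the hits
  obtain ⟨δA, hδA, hA⟩ := exists_radius_of_eventually ((hy₀.and hy₁).and (hF₀.and hW))
  obtain ⟨δL, hδL, hL⟩ := exists_radius_of_eventually_nhds hτσ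
  have hint : ∀ (x : Fin 2 → ℂ) (t : ℂ), 0 < ‖t‖ → ‖t‖ < δA →
      Sum.elim x (Complex.exp ∘ x) = 𝔟[e, N, Φ₁, Φ₂, Φ₃, t] →
      ∃ k : ℤ, k ≠ 0 ∧ ((σ t) ^ e)⁻¹ = k := by
    intro x t ht0 htδ hpt
    obtain ⟨⟨h0, -⟩, ⟨hσne, hF⟩, -⟩ := hA t ht0 htδ
    have hx0 : x 0 = (t ^ e)⁻¹ := by
      have := congrFun hpt (Sum.inl 0); simpa using this
    have hex0 : exp (x 0) = Φ₂ t / t ^ N := by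
      have := congrFun hpt (Sum.inr 0); simpa using this
    have hone : exp (x 0 - ℓ₀ t) = 1 := by
      rw [Complex.exp_sub, hex0, h0, div_self (Complex.exp_ne_zero _)]
    obtain ⟨k, hk⟩ := Complex.exp_eq_one_iff.1 hone
    rw [hx0, hF, add_sub_cancel_right] at hk
    refine ⟨k, ?_, ?_⟩
    · rintro rfl
      rw [Int.cast_zero, zero_mul] at hk
      exact mul_ne_zero h2πI (inv_ne_zero (pow_ne_zero e hσne)) hk
    · have := hk
      rw [mul_comm (k : ℂ)] at this
      exact mul_left_cancel₀ h2πI this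
  -- ### Step C: pairs and the pigeonhole on directions
  set T : Set ((Fin 2 → ℂ) × ℂ) := {p | p.1 ∈ indepExpPoints W ∧ 0 < ‖p.2‖ ∧ ‖p.2‖ < δA ∧
    Sum.elim p.1 (Complex.exp ∘ p.1) = 𝔟[e, N, Φ₁, Φ₂, Φ₃, p.2]} with hTdef
  have hT : ∀ R : ℝ, Set.Infinite {p | p ∈ T ∧ R < ‖p.2‖⁻¹} := by
    intro R hfin
    have hRpos : 0 < max R 1 := lt_of_lt_of_le one_pos (le_max_right _ _)
    apply hhit (min δA (max R 1)⁻¹) (lt_min hδA (inv_pos.2 hRpos))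
    refine (hfin.image Prod.fst).subset ?_
    rintro x ⟨hxH, t, ht0, htδ, hpt⟩
    refine ⟨(x, t), ⟨⟨hxH, ht0, htδ.trans_le (min_le_left _ _), hpt⟩, ?_⟩, rfl⟩
    have h1 : ‖t‖ < (max R 1)⁻¹ := htδ.trans_le (min_le_right _ _)
    calc R ≤ max R 1 := le_max_left _ _
      _ < ‖t‖⁻¹ := by rwa [lt_inv_comm₀ hRpos ht0]
  set L : Finset ℂ := Polynomial.nthRootsFinset (2 * e) (1 : ℂ) with hLdef
  set U : ℂ → Set ((Fin 2 → ℂ) × ℂ) := fun η => {p | σ p.2 = η * (‖σ p.2‖ : ℂ)} with hU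
  have hcov : ∀ p ∈ T, ∃ η ∈ L, p ∈ U η := by
    rintro ⟨x, t⟩ ⟨hxH, ht0, htδ, hpt⟩
    obtain ⟨k, hk, hkt⟩ := hint x t ht0 htδ hpt
    obtain ⟨-, ⟨hσne, -⟩, -⟩ := hA t ht0 htδ
    refine ⟨σ t / (‖σ t‖ : ℂ), ?_, ?_⟩
    · rw [hLdef, Polynomial.mem_nthRootsFinset (by omega)]
      exact dir_pow_eq_one he hk hkt
    · show σ t = σ t / (‖σ t‖ : ℂ) * (‖σ t‖ : ℂ)
      rw [div_mul_cancel₀ _ (by exact_mod_cast norm_ne_zero_iff.2 hσne)]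
  obtain ⟨η, hηL, hcls⟩ := exists_infinite_class hT L U hcov
  have hη1 : ‖η‖ = 1 := by
    obtain ⟨p, ⟨⟨-, hp0, hpδ, -⟩, hpU, -⟩⟩ := (hcls 0).nonempty
    obtain ⟨-, ⟨hσne, -⟩, -⟩ := hA p.2 hp0 hpδ
    have h := congrArg (fun z : ℂ => ‖z‖) hpU
    simp only [norm_mul, Complex.norm_real, Real.norm_eq_abs, abs_norm] at h
    have hn : ‖σ p.2‖ ≠ 0 := norm_ne_zero_iff.2 hσne
    field_simp at h
    linarith [h]
  have hη0 : η ≠ 0 := by rintro rfl; simp at hη1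
  set ε : ℂ := η ^ e with hεdef
  have hε : ε = 1 ∨ ε = -1 := by
    have h2e : η ^ (2 * e) = 1 := (Polynomial.mem_nthRootsFinset (by omega) (1 : ℂ)).1 hηL
    rw [mul_comm, pow_mul] at h2e
    exact sq_eq_one_iff.1 h2e
  have hεinv : ε⁻¹ = ε := by rcases hε with h | h <;> simp [h]
  -- ### Step D: the cusp form in the coordinate `s`, `σ = η s`
  set ℓu : ℂ → ℂ := fun s => ℓ₀ (τ (η * s)) with hℓu
  set ℓv : ℂ → ℂ := fun s => ℓ₁ (τ (η * s)) with hℓv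
  have hηs : AnalyticAt ℂ (fun s : ℂ => η * s) 0 := analyticAt_const.mul analyticAt_id
  have hτη : AnalyticAt ℂ (fun s : ℂ => τ (η * s)) 0 := by
    have h2 : AnalyticAt ℂ τ ((fun s : ℂ => η * s) 0) := by
      rw [show (fun s : ℂ => η * s) 0 = 0 by simp]; exact hτ
    exact AnalyticAt.comp (g := τ) (f := fun s : ℂ => η * s) (x := 0) h2 hηs
  have hτη0 : τ (η * 0) = 0 := by rw [mul_zero, hτu]; simp
  have hℓuan : AnalyticAt ℂ ℓu 0 := by
    have h2 : AnalyticAt ℂ ℓ₀ ((fun s : ℂ => τ (η * s)) 0) := by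
      rw [show (fun s : ℂ => τ (η * s)) 0 = 0 from hτη0]; exact hℓ₀
    exact AnalyticAt.comp (g := ℓ₀) (f := fun s : ℂ => τ (η * s)) (x := 0) h2 hτη
  have hℓvan : AnalyticAt ℂ ℓv 0 := by
    have h2 : AnalyticAt ℂ ℓ₁ ((fun s : ℂ => τ (η * s)) 0) := by
      rw [show (fun s : ℂ => τ (η * s)) 0 = 0 from hτη0]; exact hℓ₁
    exact AnalyticAt.comp (g := ℓ₁) (f := fun s : ℂ => τ (η * s)) (x := 0) h2 hτη
  have huη : AnalyticAt ℂ (fun s : ℂ => u (η * s)) 0 := by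
    have h2 : AnalyticAt ℂ u ((fun s : ℂ => η * s) 0) := by
      rw [show (fun s : ℂ => η * s) 0 = 0 by simp]; exact hu
    exact AnalyticAt.comp (g := u) (f := fun s : ℂ => η * s) (x := 0) h2 hηs
  set Θ : ℂ → ℂ := fun s => (Φ₁ (τ (η * s)) * ((η * u (η * s)) ^ N)⁻¹ - s ^ N * ℓv s) /
    (2 * Real.pi * I) with hΘdef
  have hΘ : AnalyticAt ℂ Θ 0 := by
    have h1 : AnalyticAt ℂ (fun s : ℂ => Φ₁ (τ (η * s))) 0 := by
      have h2 : AnalyticAt ℂ Φ₁ ((fun s : ℂ => τ (η * s)) 0) := by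
        rw [show (fun s : ℂ => τ (η * s)) 0 = 0 from hτη0]; exact hΦ₁
      exact AnalyticAt.comp (g := Φ₁) (f := fun s : ℂ => τ (η * s)) (x := 0) h2 hτη
    have h3 : AnalyticAt ℂ (fun s : ℂ => ((η * u (η * s)) ^ N)⁻¹) 0 :=
      ((analyticAt_const.mul huη).pow N).inv
        (pow_ne_zero N (mul_ne_zero hη0 (by simpa using hu0)))
    exact ((h1.mul h3).sub ((analyticAt_id.pow N).mul hℓvan)).div analyticAt_const h2πI
  obtain ⟨A, g, hg, hg0, -, hpp⟩ := exists_principal_part hΘ N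
  -- ### Step E: the branch identity `𝔟(τ(ηs)) = 𝔠(s)` near `0`
  have hηcont : Tendsto (fun s : ℂ => τ (η * s)) (𝓝[≠] 0) (𝓝[≠] 0) := by
    refine tendsto_nhdsWithin_of_tendsto_nhds_of_eventually_within _ ?_ ?_
    · have := hτη.continuousAt.tendsto
      rw [hτη0] at this
      exact this.mono_left nhdsWithin_le_nhds
    · -- `τ (η s) ≠ 0` for `s ≠ 0` small: `τ (η s) = η s u(η s)`
      have hune : ∀ᶠ s in 𝓝 (0 : ℂ), u (η * s) ≠ 0 :=
        huη.continuousAt.eventually_ne (by simpa using hu0)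
      filter_upwards [eventually_nhdsWithin_of_eventually_nhds hune, self_mem_nhdsWithin]
        with s hus hs0
      have hsne : s ≠ 0 := by rintro rfl; exact hs0 (Set.mem_singleton 0)
      rw [Set.mem_compl_iff, Set.mem_singleton_iff, hτu]
      exact mul_ne_zero (mul_ne_zero hη0 hsne) hus
  have hident : ∀ᶠ s in 𝓝[≠] (0 : ℂ),
      𝔟[e, N, Φ₁, Φ₂, Φ₃, τ (η * s)] = 𝔠[ε, e, A, g, ℓu, ℓv, s] ∧
        𝔟[e, N, Φ₁, Φ₂, Φ₃, τ (η * s)] ∈ W := by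
    have hback := hηcont.eventually ((hy₀.and hy₁).and (hF₀.and hW))
    have hright : ∀ᶠ s in 𝓝 (0 : ℂ), σ (τ (η * s)) = η * s := by
      have := hηs.continuousAt.tendsto
      rw [mul_zero] at this
      exact this.eventually hστ
    have hune : ∀ᶠ s in 𝓝 (0 : ℂ), u (η * s) ≠ 0 :=
      huη.continuousAt.eventually_ne (by simpa using hu0)
    filter_upwards [hback, hpp, eventually_nhdsWithin_of_eventually_nhds (hright.and hune),
      self_mem_nhdsWithin] with s ⟨⟨h0, h1⟩, ⟨hσne, hF⟩, hWs⟩ hps ⟨hrs, hus⟩ hs0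
    have hsne : s ≠ 0 := by rintro rfl; exact hs0 (Set.mem_singleton 0)
    refine ⟨?_, hWs⟩
    have htu : τ (η * s) = η * s * u (η * s) := hτu _
    funext k
    rcases k with k | k <;> fin_cases k
    · -- `x₀`
      simp only [Sum.elim_inl, Fin.zero_eta, Fin.isValue, Matrix.cons_val_zero]
      rw [hF, hrs, mul_pow, mul_inv, ← hεdef, hεinv, inv_pow]
      simp only [hℓu]; ring
    · -- `x₁`
      simp only [Sum.elim_inl, Fin.mk_one, Fin.isValue, Matrix.cons_val_one, Matrix.cons_val_zero]
      rw [← hps]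
      simp only [hΘdef, hℓv]
      rw [htu]
      field_simp
      ring
    · -- `y₀`
      simp only [Sum.elim_inr, Fin.zero_eta, Fin.isValue, Matrix.cons_val_zero]
      rw [h0]
    · -- `y₁`
      simp only [Sum.elim_inr, Fin.mk_one, Fin.isValue, Matrix.cons_val_one, Matrix.cons_val_zero]
      rw [h1]
  -- the substitution lands in the punctured disc `0 < |t| < δA`
  have hballA : ∀ᶠ t in 𝓝[≠] (0 : ℂ), 0 < ‖t‖ ∧ ‖t‖ < δA := by
    filter_upwards [eventually_nhdsWithin_of_eventually_nhds
      (eventually_norm_sub_lt 0 hδA |>.mono fun t ht => by simpa using ht), self_mem_nhdsWithin]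
      with t ht ht0
    have htne : t ≠ 0 := by rintro rfl; exact ht0 (Set.mem_singleton 0)
    exact ⟨norm_pos_iff.2 htne, ht⟩
  have hTev : ∀ᶠ s in 𝓝[≠] (0 : ℂ), 0 < ‖τ (η * s)‖ ∧ ‖τ (η * s)‖ < δA :=
    hηcont.eventually hballA
  obtain ⟨ρ₀, hρ₀, hρ⟩ := exists_radius_of_eventually (hident.and hTev)
  -- ### Step F: conclusion
  refine ⟨ε, A, g, ℓu, ℓv, ρ₀, fun s => τ (η * s), δA, hε, hρ₀, hg, hg0, hℓuan, hℓvan,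
    fun s hs0 hsρ => ?_, fun δ hδ => ?_, hδA, hτη, hτη0, fun t ht0 htδ => ?_, fun s hs0 hsρ => ?_⟩
  · obtain ⟨⟨heq, hmem⟩, -⟩ := hρ s hs0 hsρ
    rw [← heq]; exact hmem
  · -- hits of the class with small `σ t`, at real positive parameters
    obtain ⟨δσ, hδσ, hσδ⟩ : ∃ δσ > 0, ∀ t : ℂ, ‖t‖ < δσ → ‖σ t‖ < min δ ρ₀ := by
      have h0 : σ 0 = 0 := by rw [hσw]; simp
      obtain ⟨δσ, hδσ, h⟩ :=
        Metric.continuousAt_iff.1 hσ.continuousAt (min δ ρ₀) (lt_min hδ hρ₀)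
      refine ⟨δσ, hδσ, fun t ht => ?_⟩
      have := h (by simpa [dist_eq_norm] using ht)
      simpa [dist_eq_norm, h0] using this
    have hRpos : 0 < (min δσ δL)⁻¹ := inv_pos.2 (lt_min hδσ hδL)
    have hinf := hcls (min δσ δL)⁻¹
    -- the map `p ↦ p.1` has finite fibres on the class
    intro hfin
    apply hinf
    have hsub : {p | p ∈ T ∧ p ∈ U η ∧ (min δσ δL)⁻¹ < ‖p.2‖⁻¹} ⊆
        ⋃ x ∈ {x | x ∈ indepExpPoints W ∧ ∃ ρ : ℝ, 0 < ρ ∧ ρ < δ ∧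
          Sum.elim x (Complex.exp ∘ x) = 𝔠[ε, e, A, g, ℓu, ℓv, (ρ : ℂ)]},
          (fun t : ℂ => (x, t)) '' {t : ℂ | t ^ e = (x 0)⁻¹} := by
      rintro ⟨x, t⟩ ⟨⟨hxH, ht0, htδ, hpt⟩, hpU, hpR⟩
      have hsmallt : ‖t‖ < min δσ δL := by rwa [lt_inv_comm₀ hRpos ht0, inv_inv] at hpR
      obtain ⟨-, ⟨hσne, -⟩, -⟩ := hA t ht0 htδ
      have hρpos : 0 < ‖σ t‖ := norm_pos_iff.2 hσne
      have hρsmall := hσδ t (hsmallt.trans_le (min_le_left _ _))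
      have htτ : t = τ (η * (‖σ t‖ : ℂ)) := by
        rw [← show σ t = η * (‖σ t‖ : ℂ) from hpU, hL t (hsmallt.trans_le (min_le_right _ _))]
      obtain ⟨⟨heq, -⟩, -⟩ := hρ (‖σ t‖ : ℂ) (by simpa using hρpos)
        (by simpa using hρsmall.trans_le (min_le_right _ _))
      refine Set.mem_biUnion (x := x)
        ⟨hxH, ‖σ t‖, hρpos, hρsmall.trans_le (min_le_left _ _), ?_⟩ ?_
      · rw [hpt]
        conv_lhs => rw [htτ]
        exact heq
      · refine ⟨t, ?_, rfl⟩
        have hx0 : x 0 = (t ^ e)⁻¹ := by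
          have := congrFun hpt (Sum.inl 0); simpa using this
        show t ^ e = (x 0)⁻¹
        rw [hx0, inv_inv]
    exact Set.Finite.subset
      (Set.Finite.biUnion hfin fun x _ => (finite_pow_eq he _).image _) hsub
  · -- the `t`-branch in exponential form lies in `W`
    obtain ⟨⟨h0, h1⟩, -, hWt⟩ := hA t ht0 htδ
    rw [← h0, ← h1]; exact hWt
  · -- the cusp point at `s` is the branch point at `t = τ (η s)`
    obtain ⟨⟨heq, -⟩, hT0, hTr⟩ := hρ s hs0 hsρ
    refine ⟨hT0, hTr, ?_, ?_, by simp only [hℓu], by simp only [hℓv]⟩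
    · have := congrFun heq (Sum.inl 0)
      simpa only [Sum.elim_inl, Fin.isValue, Matrix.cons_val_zero] using this
    · have := congrFun heq (Sum.inl 1)
      simpa only [Sum.elim_inl, Fin.isValue, Matrix.cons_val_one, Matrix.cons_val_zero,
        Matrix.cons_val_fin_one] using this

end Literature.NumberTheory.Transcendental

end
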